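import Summits.CriticalPhenomena.PercolationContinuityZ3.Theses.PercNearOneGluing
import Literature.Probability.Percolation.PercolationProofs
import Literature.Probability.Percolation.ConditionalPositiveAssociationProofs
import Literature.Probability.Percolation.TwoClusterConditionalAssociationProofs
import Summits.CriticalPhenomena.PercolationContinuityZ3.Theorems.PercNearOneGluingAdditiveGluingGoodBase
import Summits.CriticalPhenomena.PercolationContinuityZ3.Theorems.PercNearOneGluingAdditiveGluingLemma5AnyRelay

/-! TTRL-lite variant V124 of stmt-CriticalPhenomena-4576

**Verdict: DISPROVED.**  V124 strengthens the conclusion of the good-step inequality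
(`stub_goodStep` of the crux `PercNearOneGluing.AdditiveGluing`) from `≤ t` to `< t`.  The strict
form is false at the degenerate level `t = 0`: with `A = {b}` the relay hypothesis
`1 - t ≤ μ(b ↔ b) = 1` only forces `0 ≤ t`, while the left-hand side is a sum of non-negative
reals, so `LHS < 0` is impossible.  Witness: `n = 3`, `o = 0`, `y = 1`, `b = 2`, `A = {2}`,
`w = 𝟙_{s(0,1)}`, `t = 0`, `sel ≡ 2`.  The displayed induction hypothesis is discharged by the
isolated-observer base case `stub_goodBase stub_lemma5AnyRelay` (Kozma–Nitzan Thm 4): a weighting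
`w'` with fewer positive-degree vertices than `w` (which has two, `0` and `1`) has at most one, hence
every non-loop pair of `w'` has weight `0`, in particular every pair `s(o', y)`, `y ∉ A'`, `y ≠ o'`.
-/

namespace Summit.CriticalPhenomena.PercolationContinuityZ3.Theorems

open MeasureTheory Literature.Probability.LatticeModels Literature.Probability.Percolation
open scoped Classical BigOperators

/-- **TTRL-lite variant V124 (conclusion `≤ t` strengthened to `< t`) of the good-step inequality of
stmt-CriticalPhenomena-4576 is false.**  Counterexample: `n = 3`, `o = 0`, `b = 2`, `A = {2}`,
`w = 𝟙_{s(0,1)}`, `t = 0`, `sel ≡ 2`; the induction hypothesis holds by the isolated-observer base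
case (`stub_goodBase stub_lemma5AnyRelay`), the relay hypothesis reads `1 - 0 ≤ μ(2 ↔ 2) = 1`, and the
left-hand side is non-negative, so it is not `< 0`. [this project] -/
theorem cp4576_goodstep_var124_false : ¬ (∀ (n : ℕ) (w : Sym2 (Fin n) → unitInterval) (A : Finset (Fin n)) (o b : Fin n), b ∈ A → o ∉ A → (∃ y : Fin n, y ∉ A ∧ y ≠ o ∧ (w s(o, y) : ℝ) ≠ 0) → (∀ w' : Sym2 (Fin n) → unitInterval, (Finset.univ.filter (fun v : Fin n => ∃ u : Fin n, 0 < (w' s(u, v) : ℝ))).card < (Finset.univ.filter (fun v : Fin n => ∃ u : Fin n, 0 < (w s(u, v) : ℝ))).card → ∀ (A' : Finset (Fin n)) (o' b' : Fin n), b' ∈ A' → o' ∉ A' → ∀ (t : ℝ) (sel : Finset (Fin n) → Fin n), (∀ W, sel W ∈ A') → (∀ a ∈ A', 1 - t ≤ (prodBernoulli w').real (openConn a b')) → (prodBernoulli w').real ((⋃ a ∈ A', openConn o' a) ∩ (openConn o' b')ᶜ) + ∑ W ∈ (Finset.univ : Finset (Finset (Fin n))).filter (fun W => o' ∈ W ∧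 Disjoint W A'), (prodBernoulli w').real {ω : BondConfig (Fin n) | openCluster ω o' = (W : Set (Fin n))} * (prodBernoulli w').real (openConnIn ((W : Set (Fin n))ᶜ) (sel W) b')ᶜ ≤ t) → ∀ (t : ℝ) (sel : Finset (Fin n) → Fin n), (∀ W, sel W ∈ A) → (∀ a ∈ A, 1 - t ≤ (prodBernoulli w).real (openConn a b)) → (prodBernoulli w).real ((⋃ a ∈ A, openConn o a) ∩ (openConn o b)ᶜ) + ∑ W ∈ (Finset.univ : Finset (Finset (Fin n))).filter (fun W => o ∈ W ∧ Disjoint W A), (prodBernoulli w).real {ω : BondConfig (Fin n) | openCluster ω o = (W : Set (Fin n))} * (prodBernoulli w).real (openConnIn ((W : Set (Fin n))ᶜ) (sel W) b)ᶜ < t) := by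
  intro h
  -- the witness weighting: the single charged pair `s(0, 1)` on `Fin 3`
  set w : Sym2 (Fin 3) → unitInterval := fun e => if e = s(0, 1) then 1 else 0 with hw
  have hw01 : (w s(0, 1) : ℝ) = 1 := by simp [hw]
  have hA : (2 : Fin 3) ∈ ({2} : Finset (Fin 3)) := Finset.mem_singleton_self _
  have hoA : (0 : Fin 3) ∉ ({2} : Finset (Fin 3)) := by decide
  have hy : ∃ y : Fin 3, y ∉ ({2} : Finset (Fin 3)) ∧ y ≠ 0 ∧ (w s(0, y) : ℝ) ≠ 0 :=
    ⟨1, by decide, by decide, by rw [hw01]; exact one_ne_zero⟩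
  -- `w` has at most two positive-degree vertices (`0` and `1`)
  have hcardw : (Finset.univ.filter (fun v : Fin 3 => ∃ u : Fin 3, 0 < (w s(u, v) : ℝ))).card ≤ 2 := by
    have hsub : Finset.univ.filter (fun v : Fin 3 => ∃ u : Fin 3, 0 < (w s(u, v) : ℝ)) ⊆ {0, 1} := by
      intro v hv
      obtain ⟨u, hu⟩ := (Finset.mem_filter.1 hv).2
      have he : s(u, v) = s(0, 1) := by
        by_contra hne
        simp [hw, hne] at hu
      have key : ∀ u v : Fin 3, s(u, v) = s(0, 1) → v = 0 ∨ v = 1 := by decide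
      rcases key u v he with rfl | rfl <;> simp
    exact (Finset.card_le_card hsub).trans (by decide)
  -- the induction hypothesis: isolated-observer base case (KN Thm 4 via Lemma 5)
  have hIH : ∀ w' : Sym2 (Fin 3) → unitInterval,
      (Finset.univ.filter (fun v : Fin 3 => ∃ u : Fin 3, 0 < (w' s(u, v) : ℝ))).card <
        (Finset.univ.filter (fun v : Fin 3 => ∃ u : Fin 3, 0 < (w s(u, v) : ℝ))).card →
      ∀ (A' : Finset (Fin 3)) (o' b' : Fin 3), b' ∈ A' → o' ∉ A' →
        ∀ (t : ℝ) (sel : Finset (Fin 3) → Fin 3), (∀ W, sel W ∈ A') →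
          (∀ a ∈ A', 1 - t ≤ (prodBernoulli w').real (openConn a b')) →
          (prodBernoulli w').real ((⋃ a ∈ A', openConn o' a) ∩ (openConn o' b')ᶜ) +
            ∑ W ∈ (Finset.univ : Finset (Finset (Fin 3))).filter (fun W => o' ∈ W ∧ Disjoint W A'),
              (prodBernoulli w').real {ω : BondConfig (Fin 3) | openCluster ω o' = (W : Set (Fin 3))} *
                (prodBernoulli w').real (openConnIn ((W : Set (Fin 3))ᶜ) (sel W) b')ᶜ ≤ t := by
    intro w' hlt A' o' b' hb' ho' t sel hsel hrel
    refine stub_goodBase stub_lemma5AnyRelay 3 w' A' o' b' hb' ho' ?_ t sel hsel hrel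
    intro y _ hyo
    by_contra hne
    have hpos : 0 < (w' s(o', y) : ℝ) := lt_of_le_of_ne (w' s(o', y)).2.1 (Ne.symm hne)
    have hy' : y ∈ Finset.univ.filter (fun v : Fin 3 => ∃ u : Fin 3, 0 < (w' s(u, v) : ℝ)) :=
      Finset.mem_filter.2 ⟨Finset.mem_univ _, o', hpos⟩
    have ho'' : o' ∈ Finset.univ.filter (fun v : Fin 3 => ∃ u : Fin 3, 0 < (w' s(u, v) : ℝ)) :=
      Finset.mem_filter.2 ⟨Finset.mem_univ _, y, by rw [Sym2.eq_swap]; exact hpos⟩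
    have h2 : 2 ≤ (Finset.univ.filter (fun v : Fin 3 => ∃ u : Fin 3, 0 < (w' s(u, v) : ℝ))).card := by
      have hsub : ({o', y} : Finset (Fin 3)) ⊆
          Finset.univ.filter (fun v : Fin 3 => ∃ u : Fin 3, 0 < (w' s(u, v) : ℝ)) := by
        intro v hv
        rcases Finset.mem_insert.1 hv with rfl | hv
        · exact ho''
        · rw [Finset.mem_singleton.1 hv]; exact hy'
      have hc : ({o', y} : Finset (Fin 3)).card = 2 := Finset.card_pair (Ne.symm hyo)
      exact hc.symm.trans_le (Finset.card_le_card hsub)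
    exact absurd (lt_of_lt_of_le hlt hcardw) (not_lt.2 h2)
  -- the relay hypothesis at level `t = 0`: `μ(2 ↔ 2) = 1`
  have hrel : ∀ a ∈ ({2} : Finset (Fin 3)), 1 - (0 : ℝ) ≤ (prodBernoulli w).real (openConn a 2) := by
    intro a ha
    rw [Finset.mem_singleton.1 ha]
    have huniv : (openConn 2 2 : Set (BondConfig (Fin 3))) = Set.univ := by
      ext ω
      simp only [Set.mem_univ, iff_true]
      exact SimpleGraph.Reachable.refl _
    rw [huniv, probReal_univ]
    norm_num
  have key := h 3 w {2} 0 2 hA hoA hy hIH 0 (fun _ => 2) (fun _ => hA) hrel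
  -- but the left-hand side is non-negative
  have hnn : ∀ x z : ℝ, 0 ≤ x → 0 ≤ z → ¬ (x + z < 0) := fun x z hx hz hlt => by linarith
  exact hnn _ _ measureReal_nonneg
    (Finset.sum_nonneg fun W _ => mul_nonneg measureReal_nonneg measureReal_nonneg) key

end Summit.CriticalPhenomena.PercolationContinuityZ3.Theorems
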